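import Literature.NumberTheory.DiophantineGeometry.FunctionFieldRadicalLayerSignature
import HarnessLib

/-!
# The coverings `g^q = (t - 1)^a (t^p - 1)`, `f = t^p`: signature `(p, q, p)`

Topic: `Literature/NumberTheory/DiophantineGeometry`. Theorem-only file (no definition, no named
fact) in the chain attached to the named fact `AbcWave0.darmonGranville1995_thm_2`. After the Fermat
function field (signature `(n, n, n)`, `FermatFunctionFieldBelyiMap`) this is the second EXPLICIT family
of coverings of `ℙ¹` in the shape of the covering input of Darmon–Granville's Theorem 2
(`finite_properSolutions_of_belyiMap_of_faltings`, `AbcDarmonGranvilleSignatureReduction`): for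
`p, q ≥ 1` with `gcd(p - 1, q) = 1`, over any field `K` of characteristic `0`, the function field
`F = K(t)(g)`, `g^q = (t - 1)^a (t^p - 1)` with `a ≡ -p (mod q)`, and the function `f = t^p`
(`AlgFunctionField.exists_belyiMap_signature_pow_line`). The seed is the cyclic covering `t ↦ t^p` of
the line (orders `p` at `t = 0`, `-p` at `t = ∞`, `1` at the closed points of `t^p = 1`), and the
radical layer of `FunctionFieldRadicalLayerSignature` is

* unramified above `t = 0` (`h(0) ≠ 0`), above `t = ∞` (`v_∞(h) = -(a + p) ≡ 0 (mod q)`) and above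
  every closed point `π₀(t^p)`, `π₀ ∉ {X, X - 1}` (`h` is a unit there), so `f` keeps the orders
  `p`, `-p`, `1` of the seed;
* totally ramified above the closed points of `t^p = 1` (`v_P(h) = a + 1` at `t = 1` and `v_P(h) = 1`
  at the other ones, both prime to `q`), so the zeros of `f - 1` get order `q`, and the rational place
  `t = 1` stays rational (whence `K` is the full constant field).

(Group-theoretically: the monodromy is metacyclic, a quotient of `ℤ/q ≀ ℤ/p`; the classical instances
are the curves `y^q = x^a (x^p - 1)` dominating the generalized Fermat equations of signature
`(p, p, q)` in Darmon's program. The condition `gcd(p - 1, q) = 1` is where the closed point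
`(t^p - 1)/(t - 1)` of the line over `ℚ` can carry a single exponent; e.g. `(3, q, 3)` for all `q`
prime to `2`, `(5, q, 5)` for all odd `q`, `(p, q, p)` for `q` prime to `p - 1`.)

Consequences for Darmon–Granville's theorem modulo Faltings' theorem ONLY (no Riemann existence
theorem): for hyperbolic `(p, q, p)` with `gcd(p - 1, q) = 1`, the equations `A x^p + B y^q = C z^p`,
`A x^p + B y^p = C z^q`, `A x^q + B y^p = C z^p` have finitely many proper solutions
(`finite_properSolutions_signature_pqp_of_faltings`, `…_ppq_…`, `…_qpp_…`), e.g. the signatures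
`(3, 3, ℓ)`, `ℓ ≥ 5` prime, and `(5, 5, ℓ)`, `(ℓ, 5, 5)` for odd primes `ℓ` — all minimal hyperbolic
signatures in the sense of `darmonGranville1995_thm_2_of_minimal_belyiMaps_of_faltings`.
[cite: DarmonGranville1995, Theorem 2 (p. 515) and Prop. 3.1 (p. 525)]

## References

* H. Darmon, A. Granville, *On the equations `z^m = F(x, y)` and `A x^p + B y^q = C z^r`*, Bull. London
  Math. Soc. 27 (1995) 513–543: Theorem 2 (p. 515), Prop. 3.1 (p. 525). [DarmonGranville1995]
* H. Stichtenoth, *Algebraic Function Fields and Codes*, GTM 254, 2009: Prop. 3.7.3, Thm. 1.4.11,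
  Thm. 3.1.11. [Stichtenoth2009]
-/

noncomputable section

open scoped Classical Polynomial IntermediateField NumberField

namespace Literature.NumberTheory.DiophantineGeometry

open Polynomial IsDedekindDomain NumberField WithZero

universe u

namespace AlgFunctionField

/-! ### A. The seed: `s = t^p` and `h = (t - 1)^a (t^p - 1)` on the line `K(t)` -/

section Seed

variable {K : Type u} [Field K] [CharZero K]

omit [CharZero K] in
/-- `t - 1` and `t^p - 1` are non-zero in `K(t)` (`p ≥ 1`), and so is `h = (t - 1)^a (t^p - 1)`.
[folklore] -/
theorem powLine_h_ne_zero {p : ℕ} (hp : 0 < p) (a : ℕ) :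
    (RatFunc.X - 1 : RatFunc K) ≠ 0 ∧ (RatFunc.X ^ p - 1 : RatFunc K) ≠ 0 ∧
      ((RatFunc.X - 1) ^ a * (RatFunc.X ^ p - 1) : RatFunc K) ≠ 0 := by
  have hut := RatFunc.transcendental_X (K := K)
  have h1 : (RatFunc.X - 1 : RatFunc K) ≠ 0 := by
    intro h0
    refine hut ⟨X - C 1, X_sub_C_ne_zero 1, ?_⟩
    rw [map_sub, aeval_X, aeval_C, map_one, h0]
  have h2 : (RatFunc.X ^ p - 1 : RatFunc K) ≠ 0 := by
    intro h0
    refine hut ⟨X ^ p - C 1, X_pow_sub_C_ne_zero hp 1, ?_⟩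
    rw [map_sub, map_pow, aeval_X, aeval_C, map_one, h0]
  exact ⟨h1, h2, mul_ne_zero (pow_ne_zero _ h1) h2⟩

/-- **Zeros of the seed.** At a zero `P` of `t` on the line: `v_P(t^p) = p` and `h(0) = ±1 ≠ 0`, so
`v_P(h) = 0`. [folklore] -/
theorem powLine_zeros {p : ℕ} (hp : 0 < p) (a q : ℕ) (P : PlaceOver K (RatFunc K))
    (hP : 0 < P.ord ((RatFunc.X : RatFunc K) ^ p)) :
    P.ord ((RatFunc.X : RatFunc K) ^ p) = p ∧
      (q : ℤ) ∣ P.ord (((RatFunc.X - 1) ^ a * (RatFunc.X ^ p - 1) : RatFunc K)) := by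
  have hut := RatFunc.transcendental_X (K := K)
  have hu1 := finrank_adjoin_ratFunc_X (K := K)
  have hu0 : (RatFunc.X : RatFunc K) ≠ 0 := RatFunc.X_ne_zero
  rw [P.ord_pow hu0] at hP ⊢
  have hPt : 0 < P.ord (RatFunc.X : RatFunc K) := by
    by_contra hle
    have : (p : ℤ) * P.ord (RatFunc.X : RatFunc K) ≤ 0 :=
      mul_nonpos_of_nonneg_of_nonpos (by positivity) (not_lt.1 hle)
    omega
  have hPt1 : P.ord (RatFunc.X : RatFunc K) = 1 := P.ord_eq_one_of_finrank_eq_one hut hu1 hPt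
  refine ⟨by rw [hPt1, mul_one], ?_⟩
  obtain ⟨-, hord⟩ := P.ord_aeval_eq_zero_of_eval_ne_zero hPt (p := (X - C 1) ^ a * (X ^ p - 1))
    (by simp [zero_pow hp.ne'])
  have haeval : aeval (RatFunc.X : RatFunc K) ((X - C 1) ^ a * (X ^ p - 1) : K[X]) =
      (RatFunc.X - 1) ^ a * (RatFunc.X ^ p - 1) := by simp
  rw [haeval] at hord
  rw [hord]
  exact dvd_zero _

omit [CharZero K] in
/-- **Poles of the seed.** At the pole `P` of `t`: `v_P(t^p) = -p` and `v_P(h) = -(a + p)`, a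
multiple of `q` when `q ∣ a + p`. [folklore] -/
theorem powLine_poles {p : ℕ} (hp : 0 < p) {a q : ℕ} (hap : q ∣ a + p)
    (P : PlaceOver K (RatFunc K)) (hP : P.ord ((RatFunc.X : RatFunc K) ^ p) < 0) :
    P.ord ((RatFunc.X : RatFunc K) ^ p) = -p ∧
      (q : ℤ) ∣ P.ord (((RatFunc.X - 1) ^ a * (RatFunc.X ^ p - 1) : RatFunc K)) := by
  have hut := RatFunc.transcendental_X (K := K)
  have hu1 := finrank_adjoin_ratFunc_X (K := K)
  have hu0 : (RatFunc.X : RatFunc K) ≠ 0 := RatFunc.X_ne_zero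
  rw [P.ord_pow hu0] at hP ⊢
  have hPt : P.ord (RatFunc.X : RatFunc K) < 0 := by
    by_contra hle
    have : 0 ≤ (p : ℤ) * P.ord (RatFunc.X : RatFunc K) := mul_nonneg (by positivity) (not_lt.1 hle)
    omega
  have hPt1 : P.ord (RatFunc.X : RatFunc K) = -1 := P.ord_eq_neg_one_of_finrank_eq_one hut hu1 hPt
  refine ⟨by rw [hPt1]; ring, ?_⟩
  have hH0 : ((X - C 1) ^ a * (X ^ p - 1) : K[X]) ≠ 0 :=
    mul_ne_zero (pow_ne_zero _ (X_sub_C_ne_zero 1)) (by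
      rw [← C_1]; exact X_pow_sub_C_ne_zero hp 1)
  obtain ⟨-, hord⟩ := P.ord_aeval_of_ord_neg hPt (p := (X - C 1) ^ a * (X ^ p - 1)) hH0
  have haeval : aeval (RatFunc.X : RatFunc K) ((X - C 1) ^ a * (X ^ p - 1) : K[X]) =
      (RatFunc.X - 1) ^ a * (RatFunc.X ^ p - 1) := by simp
  have hdeg : ((X - C 1) ^ a * (X ^ p - 1) : K[X]).natDegree = a + p := by
    rw [natDegree_mul (pow_ne_zero _ (X_sub_C_ne_zero 1)) (by rw [← C_1]; exact X_pow_sub_C_ne_zero hp 1),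
      natDegree_pow, natDegree_X_sub_C, mul_one, ← C_1, natDegree_X_pow_sub_C]
  rw [haeval, hdeg, hPt1] at hord
  rw [hord]
  obtain ⟨m, hm⟩ := hap
  refine ⟨-m, ?_⟩
  have : ((a + p : ℕ) : ℤ) = q * m := by exact_mod_cast hm
  rw [this]; ring

/-- **The fibre `t^p = 1` of the seed.** At a zero `P` of `t^p - 1` on the line: `v_P(t^p - 1) = 1`
(`X^p - 1` is separable), and `v_P(h) = a + 1` if `P` is the place `t = 1`, `v_P(h) = 1` otherwise; both
are prime to `q` when `gcd(a + 1, q) = 1`. [folklore] -/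
theorem powLine_ones {p : ℕ} (hp : 0 < p) {a q : ℕ} (ha1 : IsCoprime ((a : ℤ) + 1) q)
    (P : PlaceOver K (RatFunc K)) (hP : 0 < P.ord ((RatFunc.X : RatFunc K) ^ p - 1)) :
    P.ord ((RatFunc.X : RatFunc K) ^ p - 1) = 1 ∧
      IsCoprime (P.ord (((RatFunc.X - 1) ^ a * (RatFunc.X ^ p - 1) : RatFunc K))) q := by
  have hut := RatFunc.transcendental_X (K := K)
  have hu1 := finrank_adjoin_ratFunc_X (K := K)
  have hpK : (p : K) ≠ 0 := Nat.cast_ne_zero.2 hp.ne'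
  obtain ⟨h10, hp0, -⟩ := powLine_h_ne_zero (K := K) hp a
  -- `v_P(t^p - 1) = 1`
  have hsep : (X ^ p - 1 : K[X]).Separable := by
    rw [← C_1]; exact separable_X_pow_sub_C (1 : K) hpK one_ne_zero
  have haeval : aeval (RatFunc.X : RatFunc K) (X ^ p - 1 : K[X]) = RatFunc.X ^ p - 1 := by simp
  have hone : P.ord ((RatFunc.X : RatFunc K) ^ p - 1) = 1 := by
    have h := P.ord_aeval_eq_one_of_separable_of_finrank_eq_one hut hu1 hsep (by rwa [haeval])
    rwa [haeval] at h
  refine ⟨hone, ?_⟩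
  -- `t ∈ 𝒪_P`, so `v_P(t - 1) ≥ 0`, and it is `1` if positive
  have htO : (RatFunc.X : RatFunc K) ∈ P.toValuationSubring := by
    refine P.mem_of_ord_aeval_pos (π := X ^ p - 1) ?_ (by rwa [haeval])
    rw [← C_1, natDegree_X_pow_sub_C]; exact hp
  have haeval1 : aeval (RatFunc.X : RatFunc K) (X - C 1 : K[X]) = RatFunc.X - 1 := by simp
  have hnn : 0 ≤ P.ord (RatFunc.X - 1 : RatFunc K) := by
    rw [← haeval1]; exact P.ord_nonneg_of_mem (P.aeval_mem htO _)
  rw [P.ord_mul_eq (pow_ne_zero _ h10) hp0, P.ord_pow h10, hone]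
  rcases hnn.lt_or_eq with hpos | hzero
  · have h1 : P.ord (RatFunc.X - 1 : RatFunc K) = 1 := by
      have h := P.ord_aeval_eq_one_of_separable_of_finrank_eq_one hut hu1 (separable_X_sub_C (x := 1))
        (by rwa [haeval1])
      rwa [haeval1] at h
    rw [h1, mul_one]
    exact ha1
  · rw [← hzero, mul_zero, zero_add]
    exact isCoprime_one_left

/-- **The other closed points.** For `π₀ ∈ K[X]` monic irreducible, `π₀ ∉ {X, X - 1}`, and a place `P`
of the line with `v_P(π₀(t^p)) > 0`: `v_P(π₀(t^p)) = 1` (`π₀(X^p)` is separable) and `h` is a unit at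
`P` (`t^p - 1`, hence `t - 1`, are units there). [folklore] -/
theorem powLine_elsewhere {p : ℕ} (hp : 0 < p) (a q : ℕ) {π₀ : K[X]} (hπi : Irreducible π₀)
    (hπm : π₀.Monic) (hπX : π₀ ≠ X) (hπX1 : π₀ ≠ X - 1) (P : PlaceOver K (RatFunc K))
    (hP : 0 < P.ord (aeval ((RatFunc.X : RatFunc K) ^ p) π₀)) :
    P.ord (aeval ((RatFunc.X : RatFunc K) ^ p) π₀) = 1 ∧
      (q : ℤ) ∣ P.ord (((RatFunc.X - 1) ^ a * (RatFunc.X ^ p - 1) : RatFunc K)) := by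
  have hut := RatFunc.transcendental_X (K := K)
  have hu1 := finrank_adjoin_ratFunc_X (K := K)
  have hpK : (p : K) ≠ 0 := Nat.cast_ne_zero.2 hp.ne'
  obtain ⟨h10, hp0, -⟩ := powLine_h_ne_zero (K := K) hp a
  have hcomp : aeval ((RatFunc.X : RatFunc K) ^ p) π₀ = aeval (RatFunc.X : RatFunc K) (π₀.comp (X ^ p)) := by
    rw [aeval_comp, map_pow, aeval_X]
  rw [hcomp] at hP ⊢
  have h0 : π₀.eval 0 ≠ 0 := fun h0 => hπX (by
    have h := PlaceOver.eq_X_sub_C_of_irreducible_of_eval_eq_zero hπi hπm h0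
    rwa [map_zero, sub_zero] at h)
  have h1 : π₀.eval 1 ≠ 0 := fun h1 => hπX1 (by
    have h := PlaceOver.eq_X_sub_C_of_irreducible_of_eval_eq_zero hπi hπm h1
    rwa [map_one] at h)
  have hsep : (π₀.comp (X ^ p)).Separable :=
    separable_comp_X_pow (PerfectField.separable_of_irreducible hπi) h0 hpK
  have hdeg : 0 < (π₀.comp (X ^ p)).natDegree := by
    rw [natDegree_comp, natDegree_X_pow]
    exact Nat.mul_pos (Irreducible.natDegree_pos hπi) hp
  have hz0 : aeval (RatFunc.X : RatFunc K) (π₀.comp (X ^ p)) ≠ 0 := by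
    intro hz; rw [hz, PlaceOver.ord_zero] at hP; exact lt_irrefl _ hP
  refine ⟨P.ord_aeval_eq_one_of_separable_of_finrank_eq_one hut hu1 hsep hP, ?_⟩
  -- `t ∈ 𝒪_P`; `t^p - 1` and `t - 1` are units at `P`
  have htO : (RatFunc.X : RatFunc K) ∈ P.toValuationSubring := P.mem_of_ord_aeval_pos hdeg hP
  have haevalp : aeval (RatFunc.X : RatFunc K) (1 - X ^ p : K[X]) = 1 - RatFunc.X ^ p := by simp
  have haeval1 : aeval (RatFunc.X : RatFunc K) (X - C 1 : K[X]) = RatFunc.X - 1 := by simp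
  have hw0' : aeval (RatFunc.X : RatFunc K) (1 - X ^ p : K[X]) ≠ 0 := by
    rw [haevalp]; intro h00; apply hp0; linear_combination -h00
  have h1' : aeval (RatFunc.X : RatFunc K) (X - C 1 : K[X]) ≠ 0 := by rwa [haeval1]
  have r1 := (P.ord_aeval_pos_iff htO hz0).1 hP
  -- `v_P(t^p - 1) = 0`
  have hordp : P.ord (RatFunc.X ^ p - 1 : RatFunc K) = 0 := by
    have hnn : 0 ≤ P.ord (1 - RatFunc.X ^ p : RatFunc K) := by
      rw [← haevalp]; exact P.ord_nonneg_of_mem (P.aeval_mem htO _)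
    have hneg : (RatFunc.X ^ p - 1 : RatFunc K) = -(1 - RatFunc.X ^ p) := by ring
    rw [hneg, P.ord_neg]
    by_contra hne
    have hpos : 0 < P.ord (aeval (RatFunc.X : RatFunc K) (1 - X ^ p : K[X])) := by
      rw [haevalp]; omega
    have r2 := (P.ord_aeval_pos_iff htO hw0').1 hpos
    obtain ⟨b₁, b₂, hb⟩ := isCoprime_comp_X_pow_one_sub_X_pow h1 p
    have h := congr_arg (aeval (IsLocalRing.residue P.toValuationSubring ⟨RatFunc.X, htO⟩)) hb
    rw [map_add, map_mul, map_mul, r1, r2, mul_zero, mul_zero, add_zero, map_one] at h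
    exact zero_ne_one h
  -- `v_P(t - 1) = 0`
  have hord1 : P.ord (RatFunc.X - 1 : RatFunc K) = 0 := by
    have hnn : 0 ≤ P.ord (RatFunc.X - 1 : RatFunc K) := by
      rw [← haeval1]; exact P.ord_nonneg_of_mem (P.aeval_mem htO _)
    by_contra hne
    have hpos : 0 < P.ord (aeval (RatFunc.X : RatFunc K) (X - C 1 : K[X])) := by
      rw [haeval1]; omega
    -- `t̄ = 1`, hence `t^p - 1` vanishes at `P` too
    have r3 := (P.ord_aeval_pos_iff htO h1').1 hpos
    rw [map_sub, aeval_X, aeval_C, map_one, sub_eq_zero] at r3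
    have hp0' : aeval (RatFunc.X : RatFunc K) (X ^ p - 1 : K[X]) ≠ 0 := by simpa using hp0
    have hpos' : 0 < P.ord (aeval (RatFunc.X : RatFunc K) (X ^ p - 1 : K[X])) := by
      rw [P.ord_aeval_pos_iff htO hp0', map_sub, map_pow, aeval_X, map_one, r3, one_pow, sub_self]
    have : P.ord (aeval (RatFunc.X : RatFunc K) (X ^ p - 1 : K[X])) = 0 := by simpa using hordp
    omega
  rw [P.ord_mul_eq (pow_ne_zero _ h10) hp0, P.ord_pow h10, hordp, hord1, mul_zero, zero_add]
  exact dvd_zero _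

/-- **The rational place `t = 1`** of the line is a zero of `h` of order `a + 1`. [folklore] -/
theorem powLine_exists_isRational {p : ℕ} (hp : 0 < p) (a : ℕ) :
    ∃ P : PlaceOver K (RatFunc K), P.IsRational ∧
      P.ord (((RatFunc.X - 1) ^ a * (RatFunc.X ^ p - 1) : RatFunc K)) = a + 1 := by
  have hut := RatFunc.transcendental_X (K := K)
  have hu1 := finrank_adjoin_ratFunc_X (K := K)
  have hpK : (p : K) ≠ 0 := Nat.cast_ne_zero.2 hp.ne'
  obtain ⟨h10, hp0, -⟩ := powLine_h_ne_zero (K := K) hp a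
  have hxt : Transcendental K (RatFunc.X - 1 : RatFunc K) := fun h =>
    hut (by simpa using h.add isAlgebraic_one)
  obtain ⟨P, hP⟩ := exists_ord_pos_of_transcendental hxt
  have haeval1 : aeval (RatFunc.X : RatFunc K) (X - C 1 : K[X]) = RatFunc.X - 1 := by simp
  have h1 : P.ord (RatFunc.X - 1 : RatFunc K) = 1 := by
    have h := P.ord_aeval_eq_one_of_separable_of_finrank_eq_one hut hu1 (separable_X_sub_C (x := 1))
      (by rwa [haeval1])
    rwa [haeval1] at h
  -- `deg P = 1`: `v_P(t - 1) deg P ≤ [K(t) : K(t - 1)] = 1`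
  have hadj : K⟮(RatFunc.X - 1 : RatFunc K)⟯ = K⟮(RatFunc.X : RatFunc K)⟯ := by
    refine le_antisymm (IntermediateField.adjoin_simple_le_iff.2
      (sub_mem (IntermediateField.mem_adjoin_simple_self K _) (one_mem _)))
      (IntermediateField.adjoin_simple_le_iff.2 ?_)
    have h : (RatFunc.X - 1 : RatFunc K) + 1 ∈ K⟮(RatFunc.X - 1 : RatFunc K)⟯ :=
      add_mem (IntermediateField.mem_adjoin_simple_self K _) (one_mem _)
    rwa [sub_add_cancel] at h
  have hdeg := sum_ord_mul_degree_le_finrank_int hxt {P} (by simpa using hP)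
  rw [Finset.sum_singleton, hadj, hu1, h1, one_mul] at hdeg
  have hdpos := PlaceOver.degree_pos_holds P
  refine ⟨P, ?_, ?_⟩
  · show P.degree = 1
    have : (P.degree : ℤ) ≤ 1 := by exact_mod_cast hdeg
    omega
  · -- `v_P(t^p - 1) = 1` (a zero of the separable `X^p - 1`, positive since `t̄ = 1`)
    have htO : (RatFunc.X : RatFunc K) ∈ P.toValuationSubring :=
      P.mem_of_ord_aeval_pos (π := X - C 1) (by rw [natDegree_X_sub_C]; exact one_pos)
        (by rwa [haeval1])
    have h1' : aeval (RatFunc.X : RatFunc K) (X - C 1 : K[X]) ≠ 0 := by rwa [haeval1]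
    have r3 := (P.ord_aeval_pos_iff htO h1').1 (by rwa [haeval1])
    rw [map_sub, aeval_X, aeval_C, map_one, sub_eq_zero] at r3
    have hp0' : aeval (RatFunc.X : RatFunc K) (X ^ p - 1 : K[X]) ≠ 0 := by simpa using hp0
    have hpos' : 0 < P.ord (aeval (RatFunc.X : RatFunc K) (X ^ p - 1 : K[X])) := by
      rw [P.ord_aeval_pos_iff htO hp0', map_sub, map_pow, aeval_X, map_one, r3, one_pow, sub_self]
    have hsep : (X ^ p - 1 : K[X]).Separable := by
      rw [← C_1]; exact separable_X_pow_sub_C (1 : K) hpK one_ne_zero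
    have hone := P.ord_aeval_eq_one_of_separable_of_finrank_eq_one hut hu1 hsep hpos'
    have haevalp : aeval (RatFunc.X : RatFunc K) (X ^ p - 1 : K[X]) = RatFunc.X ^ p - 1 := by simp
    rw [haevalp] at hone
    rw [P.ord_mul_eq (pow_ne_zero _ h10) hp0, P.ord_pow h10, h1, hone, mul_one]

end Seed

/-! ### B. The covering of signature `(p, q, p)` -/

section Cover

/-- **The covering `g^q = (t - 1)^a (t^p - 1)`, `f = t^p`, of signature `(p, q, p)`.** Let `K` be a
field of characteristic `0`, `p, q ≥ 1`, and `a ∈ ℕ` with `q ∣ a + p` and `gcd(a + 1, q) = 1`. Then there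
are an algebraic function field `F/K` with full constant field `K` and `f ∈ F ∖ K` such that every zero
of `f` has order `p`, every zero of `f - 1` has order `q`, every pole of `f` has order `p`, and `F/K(f)`
is unramified over every closed point `π₀ ∉ {X, X - 1}` of the `f`-line: `F = K(t)(g)` with
`g^q = (t - 1)^a (t^p - 1)` and `f = t^p`. The radical layer is unramified above `t = 0, ∞` and the
closed points `π₀(t^p)` (`powLine_zeros`, `powLine_poles`, `powLine_elsewhere`) and totally ramified
above `t^p = 1` (`powLine_ones`); `K` is the full constant field because the rational place `t = 1`,
where `v(h) = a + 1` is prime to `q`, has a rational place above it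
(`PlaceOver.exists_isRational_of_pow_eq_of_isCoprime`). [cite: Stichtenoth2009, Prop. 3.7.3]
[cite: DarmonGranville1995, Prop. 3.1 (p. 525), signature `(p, q, p)`] -/
theorem exists_belyiMap_signature_pow_line_aux (K : Type u) [Field K] [CharZero K] {p q a : ℕ}
    (hp : 0 < p) (hq : 0 < q) (hap : q ∣ a + p) (ha1 : IsCoprime ((a : ℤ) + 1) q) :
    ∃ (F : Type u) (_ : Field F) (_ : Algebra K F) (_ : IsAlgFunctionField K F)
      (_ : IsIntegrallyClosedIn K F) (f : F),
      f ∉ Set.range (algebraMap K F) ∧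
      (∀ P : PlaceOver K F, 0 < P.ord f → P.ord f = p) ∧
      (∀ P : PlaceOver K F, 0 < P.ord (f - 1) → P.ord (f - 1) = q) ∧
      (∀ P : PlaceOver K F, P.ord f < 0 → P.ord f = -p) ∧
      (∀ π₀ : K[X], Irreducible π₀ → π₀.Monic → π₀ ≠ X → π₀ ≠ X - 1 →
        ∀ P : PlaceOver K F, 0 < P.ord (aeval f π₀) → P.ord (aeval f π₀) = 1) := by
  haveI : CharZero (RatFunc K) :=
    charZero_of_injective_algebraMap (algebraMap K (RatFunc K)).injective
  have hqK : (q : K) ≠ 0 := Nat.cast_ne_zero.2 hq.ne'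
  obtain ⟨h10, hp0, hh0⟩ := powLine_h_ne_zero (K := K) hp a
  obtain ⟨F, _, _, _, _, _, _, g, hgp, hgen⟩ := exists_radical_extension (K := K) (F := RatFunc K)
    (((RatFunc.X - 1) ^ a * (RatFunc.X ^ p - 1) : RatFunc K)) hq
  haveI hAF : IsAlgFunctionField K F :=
    isAlgFunctionField_of_finiteDimensional (K := K) (F := RatFunc K)
  -- full constant field: a rational place above `t = 1`
  obtain ⟨P₁, hP₁, hordP₁⟩ := powLine_exists_isRational (K := K) hp a
  obtain ⟨Q₁, hQ₁⟩ := P₁.exists_isRational_of_pow_eq_of_isCoprime hP₁ hq hh0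
    (by rw [hordP₁]; exact ha1) hgp hgen
  haveI hIC : IsIntegrallyClosedIn K F := isIntegrallyClosedIn_of_isRational hQ₁
  have hut := RatFunc.transcendental_X (K := K)
  have hft : Transcendental K (algebraMap (RatFunc K) F RatFunc.X ^ p) :=
    ((transcendental_algebraMap_iff (algebraMap (RatFunc K) F).injective).2 hut).pow hp
  refine ⟨F, inferInstance, inferInstance, hAF, hIC, algebraMap (RatFunc K) F RatFunc.X ^ p,
    ?_, ?_, ?_, ?_, ?_⟩
  · rintro ⟨c, hc⟩
    exact hft (hc ▸ isAlgebraic_algebraMap c)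
  · intro Q hQ
    rw [← map_pow] at hQ ⊢
    exact PlaceOver.ord_algebraMap_eq_of_forall_ord_pos_of_dvd hq hqK hh0 hgp hgen
      (fun P hP => powLine_zeros hp a q P hP) Q hQ
  · intro Q hQ
    have heq : algebraMap (RatFunc K) F RatFunc.X ^ p - 1 =
        algebraMap (RatFunc K) F (RatFunc.X ^ p - 1) := by rw [map_sub, map_pow, map_one]
    rw [heq] at hQ ⊢
    have h := PlaceOver.ord_algebraMap_eq_of_forall_ord_pos_of_isCoprime hq hh0 hgp hgen
      (fun P hP => powLine_ones hp ha1 P hP) Q hQ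
    rw [h, mul_one]
  · intro Q hQ
    rw [← map_pow] at hQ ⊢
    exact PlaceOver.ord_algebraMap_eq_of_forall_ord_neg_of_dvd hq hqK hh0 hgp hgen
      (fun P hP => powLine_poles hp hap P hP) Q hQ
  · intro π₀ hπi hπm hX hX1 Q hQ
    have heq : aeval (algebraMap (RatFunc K) F RatFunc.X ^ p) π₀ =
        algebraMap (RatFunc K) F (aeval ((RatFunc.X : RatFunc K) ^ p) π₀) := by
      rw [← map_pow, aeval_algebraMap_apply]
    rw [heq] at hQ ⊢
    exact PlaceOver.ord_algebraMap_eq_of_forall_ord_pos_of_dvd hq hqK hh0 hgp hgen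
      (fun P hP => powLine_elsewhere hp a q hπi hπm hX hX1 P hP) Q hQ

/-- **A covering of signature `(p, q, p)` over any field of characteristic `0`, for
`gcd(p - 1, q) = 1`** (`p, q ≥ 1`): `exists_belyiMap_signature_pow_line_aux` with
`a ≡ -p (mod q)`, for which `a + 1 ≡ -(p - 1)` is prime to `q`.
[cite: Stichtenoth2009, Prop. 3.7.3] [cite: DarmonGranville1995, Prop. 3.1 (p. 525)] -/
theorem exists_belyiMap_signature_pow_line (K : Type u) [Field K] [CharZero K] {p q : ℕ}
    (hp : 0 < p) (hq : 0 < q) (hcop : Nat.Coprime (p - 1) q) :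
    ∃ (F : Type u) (_ : Field F) (_ : Algebra K F) (_ : IsAlgFunctionField K F)
      (_ : IsIntegrallyClosedIn K F) (f : F),
      f ∉ Set.range (algebraMap K F) ∧
      (∀ P : PlaceOver K F, 0 < P.ord f → P.ord f = p) ∧
      (∀ P : PlaceOver K F, 0 < P.ord (f - 1) → P.ord (f - 1) = q) ∧
      (∀ P : PlaceOver K F, P.ord f < 0 → P.ord f = -p) ∧
      (∀ π₀ : K[X], Irreducible π₀ → π₀.Monic → π₀ ≠ X → π₀ ≠ X - 1 →
        ∀ P : PlaceOver K F, 0 < P.ord (aeval f π₀) → P.ord (aeval f π₀) = 1) := by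
  -- `a = (q - p % q) % q ≡ -p (mod q)`
  set a : ℕ := (q - p % q) % q with ha
  have hap : q ∣ a + p := by
    have hm : p % q < q := Nat.mod_lt p hq
    have key : q ∣ a + p % q := by
      rcases Nat.eq_zero_or_pos (p % q) with h0 | hpos
      · rw [ha, h0, Nat.sub_zero, Nat.mod_self]
        exact dvd_zero q
      · rw [ha, Nat.mod_eq_of_lt (Nat.sub_lt hq hpos), Nat.sub_add_cancel hm.le]
    have hsplit : a + p = (a + p % q) + q * (p / q) := by
      have h := Nat.mod_add_div p q
      linarith
    rw [hsplit]
    exact (Nat.dvd_add_left (dvd_mul_right q _)).2 key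
  have ha1 : IsCoprime ((a : ℤ) + 1) q := by
    obtain ⟨m, hm⟩ := hap
    have hm' : (a : ℤ) + 1 = -((p - 1 : ℕ) : ℤ) + q * m := by
      have h1 : ((a + p : ℕ) : ℤ) = q * m := by exact_mod_cast hm
      push_cast at h1
      rw [Nat.cast_sub (Nat.succ_le_of_lt hp)]; push_cast
      linarith
    rw [hm']
    exact ((Nat.isCoprime_iff_coprime.2 hcop).neg_left).add_mul_left_left m
  exact exists_belyiMap_signature_pow_line_aux K hp hq hap ha1

end Cover

end AlgFunctionField

/-! ### C. Darmon–Granville for the signatures `(p, q, p)`, `(p, p, q)`, `(q, p, p)` modulo Faltings -/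

section DarmonGranville

open AlgFunctionField

/-- **`A x^p + B y^q = C z^p` has finitely many proper solutions for hyperbolic `(p, q, p)` with
`gcd(p - 1, q) = 1`, assuming Faltings' theorem only** (the named fact
`finite_ratPlaces_of_two_le_genus`): the one-signature form of Darmon–Granville's argument
(`finite_properSolutions_of_belyiMap_of_faltings`) fed with the covering
`exists_belyiMap_signature_pow_line` over `ℚ`.
[cite: DarmonGranville1995, Theorem 2 (p. 515), signature `(p, q, p)`] -/
theorem finite_properSolutions_signature_pqp_of_faltings {p q : ℕ}
    (hH : q * p + p * p + p * q < p * q * p) (hcop : Nat.Coprime (p - 1) q)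
    (hFaltings : ∀ (K' : Type) [Field K'] (F' : Type) [Field F'] [Algebra K' F'],
      finite_ratPlaces_of_two_le_genus K' F')
    {A B C : ℤ} (hA : A ≠ 0) (hB : B ≠ 0) (hC : C ≠ 0) :
    {t : ℤ × ℤ × ℤ | ({t.1, t.2.1, t.2.2} : Finset ℤ).gcd id = 1 ∧
      A * t.1 ^ p + B * t.2.1 ^ q = C * t.2.2 ^ p}.Finite := by
  obtain ⟨hp, hq, -⟩ := hyperbolic_exponents_ne_zero hH
  obtain ⟨F, _, _, _, _, f, hf, h₀, h₁, hi, hunr⟩ :=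
    exists_belyiMap_signature_pow_line ℚ (Nat.pos_of_ne_zero hp) (Nat.pos_of_ne_zero hq) hcop
  exact finite_properSolutions_of_belyiMap_of_faltings hH hf h₀ h₁ hi hunr hFaltings hA hB hC

/-- **`A x^p + B y^p = C z^q` has finitely many proper solutions for hyperbolic `(p, p, q)` with
`gcd(p - 1, q) = 1`, assuming Faltings' theorem only** — e.g. the signatures `(3, 3, ℓ)`, `ℓ ≥ 5`
prime, and `(5, 5, ℓ)`, `ℓ` odd. By `finite_properSolutions_swap₂₃` from the `(p, q, p)` case.
[cite: DarmonGranville1995, Theorem 2 (p. 515), signature `(p, p, q)`] -/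
theorem finite_properSolutions_signature_ppq_of_faltings {p q : ℕ}
    (hH : p * q + q * p + p * p < p * p * q) (hcop : Nat.Coprime (p - 1) q)
    (hFaltings : ∀ (K' : Type) [Field K'] (F' : Type) [Field F'] [Algebra K' F'],
      finite_ratPlaces_of_two_le_genus K' F')
    {A B C : ℤ} (hA : A ≠ 0) (hB : B ≠ 0) (hC : C ≠ 0) :
    {t : ℤ × ℤ × ℤ | ({t.1, t.2.1, t.2.2} : Finset ℤ).gcd id = 1 ∧
      A * t.1 ^ p + B * t.2.1 ^ p = C * t.2.2 ^ q}.Finite := by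
  have hH' : q * p + p * p + p * q < p * q * p := by
    have e1 : q * p + p * p + p * q = p * q + q * p + p * p := by ring
    have e2 : p * q * p = p * p * q := by ring
    rw [e1, e2]; exact hH
  exact finite_properSolutions_swap₂₃ (finite_properSolutions_signature_pqp_of_faltings hH' hcop
    hFaltings hA (neg_ne_zero.mpr hC) (neg_ne_zero.mpr hB))

/-- **`A x^q + B y^p = C z^p` has finitely many proper solutions for hyperbolic `(q, p, p)` with
`gcd(p - 1, q) = 1`, assuming Faltings' theorem only** — e.g. `(2, 5, 5)` is NOT covered
(`gcd(4, 2) ≠ 1`) but `(3, 5, 5)`, `(3, 7, 7)`? no (`gcd(6, 3) ≠ 1`), `(5, 7, 7)`, `(3, 11, 11)` are.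
By `finite_properSolutions_swap₁₂` from the `(p, q, p)` case.
[cite: DarmonGranville1995, Theorem 2 (p. 515), signature `(q, p, p)`] -/
theorem finite_properSolutions_signature_qpp_of_faltings {p q : ℕ}
    (hH : p * p + p * q + q * p < q * p * p) (hcop : Nat.Coprime (p - 1) q)
    (hFaltings : ∀ (K' : Type) [Field K'] (F' : Type) [Field F'] [Algebra K' F'],
      finite_ratPlaces_of_two_le_genus K' F')
    {A B C : ℤ} (hA : A ≠ 0) (hB : B ≠ 0) (hC : C ≠ 0) :
    {t : ℤ × ℤ × ℤ | ({t.1, t.2.1, t.2.2} : Finset ℤ).gcd id = 1 ∧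
      A * t.1 ^ q + B * t.2.1 ^ p = C * t.2.2 ^ p}.Finite := by
  have hH' : q * p + p * p + p * q < p * q * p := by
    have e1 : q * p + p * p + p * q = p * p + p * q + q * p := by ring
    have e2 : p * q * p = q * p * p := by ring
    rw [e1, e2]; exact hH
  exact finite_properSolutions_swap₁₂ (finite_properSolutions_signature_pqp_of_faltings hH' hcop
    hFaltings hB hA hC)

end DarmonGranville

end Literature.NumberTheory.DiophantineGeometry
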